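import Summits.BirchSwinnertonDyer.Rank1Residual.F1Sign2.RhombicSymbolCongruence
import Summits.BirchSwinnertonDyer.BirchSwinnertonDyer.Theorems.ResidualThetaTransportAtTwoThetaLayerLambdaCongruenceAtTwoStarRhombicLattice
import Summits.BirchSwinnertonDyer.BirchSwinnertonDyer.Theorems.ResidualThetaTransportAtTwoThetaLayerLambdaCongruenceAtTwoStarOddIsogeny
import Literature.NumberTheory.EllipticCurves.ModularParametrizationDegreeHoldsProofs
import Literature.NumberTheory.EllipticCurves.PeriodLatticeRationalityUnconditionalProofs
import Literature.NumberTheory.EllipticCurves.AnalyticIsogenyDescentProofs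
import Literature.NumberTheory.EllipticCurves.IsogenyDualInseparableProofs
import Literature.NumberTheory.EllipticCurves.IsogenyFactorProofs
import Literature.NumberTheory.EllipticCurves.PointDivisibilityProofs
import Literature.NumberTheory.EllipticCurves.GaloisActionProofs
import Literature.NumberTheory.EllipticCurves.ModularCurveNeronLatticeProofs
import Literature.NumberTheory.EllipticCurves.PAdicLFunctionProofs
import HarnessLib

/-!
# Route `AlignedTransportAtTwo`, crux C1 `MainConjectureTransportAlignedAtTwo` (stmt-BirchSwinnertonDyer-22296), line `birth`
# v16: the registered support stub `stub_rhombicOfNegDisc : F1Sign2.RhombicOfNegDisc` PROVED — `Δ_W < 0` and no rational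
# `2`-torsion ⇒ the period lattice `Λ_f` of the newform of `W` is RHOMBIC

HONEST FRAMING (cell `bsd-f1-sign2`, WIDTH-5 attach seat `bsd-line-att-p4` g8; `--supports stmt-BirchSwinnertonDyer-22296`).
THEOREMS ONLY (no `def`, no named fact, no `sorry`). BSD is NOT proved by any of this; C1 is NOT closed: this file discharges
ONE registered stub (`stub_rhombicOfNegDisc`) of the C1 skeleton `Lines/birth.lean` v16 UNCONDITIONALLY, so the lead may
replace it by `rhombicOfNegDisc_holds` (the remaining stubs of v16 are 4 PRINT facts, the PRINT minus-period unit at `2`, and the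
open off-signed-twist line law).

WHAT.
* §1 `ratTwoTorsionCard_eq_one_of_forall_not_hasRationalTwoTorsionX` — the cell binder «no rational `2`-torsion abscissa»
  (`∀ x, ¬ HasRationalTwoTorsionX W x`) gives `#E(ℚ)[2] = 1` in the tree's `Γ_ℚ`-fixed-point currency (`ratTwoTorsionCard`).
* §2 `geomTorsion_two_le_ker_of_even_degree`, `exists_isogeny_odd_degree_of_ratTwoTorsionCard_eq_one` — **no rational
  `2`-torsion ⇒ out of every `ℚ`-isogeny `W → A` one of ODD degree**: if `deg ψ` is even, `ker ψ ∩ E[2]` is a non-zero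
  (Cauchy) `Γ_ℚ`-stable subgroup of `E[2] ≅ (ℤ/2)²`; were it of order `2` its non-zero point would be rational, so it is all
  of `E[2]`, `ψ = λ ∘ [2]` (Silverman AEC III.4.11, tree `Isogeny.exists_eq_comp_nsmul_of_geomTorsion_le_ker_holds'`) with
  `deg λ < deg ψ`; induct.
* §3 `isRhombic_of_Δ_neg_of_forall_not_hasRationalTwoTorsionX`, **`rhombicOfNegDisc_holds : F1Sign2.RhombicOfNegDisc`** —
  assembly: `Λ_W` is rhombic (`Δ_W < 0`, `WeierstrassCurve.neronLattice_rhombic_of_Δ_neg`); `E_f = ℂ/Λ_f` is an elliptic curve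
  over `ℚ` with Néron lattice `Λ_f` (`IsNewform0.exists_shortModel_periodLattice`); `cΛ_f ⊆ Λ_W`, `c ∈ ℤ ∖ 0`
  (`IsNewformOf.exists_maninConstant_ne_zero_holds`: Shimura's construction + Eichler–Shimura congruence + Faltings, all tree
  theorems) gives a `ℚ`-isogeny `E_f → W` (`isIsogenous_of_forall_mul_mem_lattice`), hence `W → E_f` (dual), hence one of ODD
  degree `m` (§2), whose multiplier is a REAL `α` with `αΛ_W ⊆ Λ_f`, `mΛ_f ⊆ αΛ_W`
  (`Isogeny.exists_real_mul_lattice_le_of_isNeronLatticeOf`); rhombicity passes along real scalings and odd-index inclusions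
  (`rhombic_of_rhombic_real_mul`, `rhombic_of_rhombic_sub_of_odd_index`), so `Λ_f` is rhombic, i.e. `IsRhombic f`.
The hypothesis `[W.IsGloballyMinimal]` of `RhombicOfNegDisc` is not needed (the sign of `Δ` and `E(ℚ)[2]` are model-independent).

References: [SilvermanAEC2009] III.4.11, III.6.4(b), VI.4.1(b), VI.5.3; [CremonaAlgorithms1997] §2.10 (rectangular/rhombic
period lattices), §2.14; [Knapp1993] Thm. 11.74; [BCDTJAMS2001] p. 845 «(2) ⇒ (6)».
-/

set_option autoImplicit false
-- the route's Theorems namespace repeats a component by design (summit = sub-problem, D-0017).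
set_option linter.dupNamespace false

noncomputable section

open scoped Classical MatrixGroups ModularForm ComplexConjugate

open CongruenceSubgroup Complex WeierstrassCurve
open Literature.NumberTheory.EllipticCurves Literature.NumberTheory.EllipticCurves.ModularForms
  Literature.NumberTheory.EllipticCurves.Greenberg1999
  Summit.BirchSwinnertonDyer.Rank1Residual.F1Sign2
  Summit.BirchSwinnertonDyer.BirchSwinnertonDyer.Theorems.ThetaLayerLambdaCongruenceAtTwo

namespace Summit.BirchSwinnertonDyer.BirchSwinnertonDyer.Theorems.AlignedTransportAtTwoRhombicOfNegDisc

/-! ## §1 The cell binder «no rational `2`-torsion abscissa» in `ratTwoTorsionCard` currency -/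

/-- **No rational `2`-torsion abscissa ⇒ `#E(ℚ)[2] = 1`.** A rational root `x` of the `2`-division polynomial
`4x³ + b₂x² + 2b₄x + b₆` gives the rational point `(x, −(a₁x + a₃)/2)` of order `2` (the Weierstrass equation is
`(2y + a₁x + a₃)² = 4x³ + b₂x² + 2b₄x + b₆`), i.e. `HasRationalTwoTorsionX W x`; so the binder excludes rational roots and the
tree's `ratTwoTorsionCard_eq_one_of_forall_not_isRoot` applies. [cite: SilvermanAEC2009, III.2.3 and Exercise 3.7(b)] -/
theorem ratTwoTorsionCard_eq_one_of_forall_not_hasRationalTwoTorsionX (W : WeierstrassCurve ℚ)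
    (ht : ∀ x : ℚ, ¬ HasRationalTwoTorsionX W x) : ratTwoTorsionCard W = 1 := by
  refine ratTwoTorsionCard_eq_one_of_forall_not_isRoot W fun x hx ↦ ht x ?_
  rw [isRoot_twoTorsionPolynomial_iff] at hx
  refine ⟨-(W.a₁ * x + W.a₃) / 2, ?_, by ring⟩
  rw [WeierstrassCurve.Affine.equation_iff]
  simp only [WeierstrassCurve.b₂, WeierstrassCurve.b₄, WeierstrassCurve.b₆] at hx
  linear_combination (-1 / 4 : ℚ) * hx

/-! ## §2 No rational `2`-torsion ⇒ an isogeny of odd degree -/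

section OddIsogeny

variable {W A : WeierstrassCurve ℚ} [W.IsElliptic] [A.IsElliptic]

/-- `#E[2] = 4` for the geometric `2`-torsion `geomTorsion W 2 = E(ℚ̄)[2]` (Silverman AEC III.6.4(b), tree
`card_torsionPoints_eq_sq_holds`). [cite: SilvermanAEC2009, Cor. III.6.4(b)] -/
theorem natCard_geomTorsion_two : Nat.card (geomTorsion W 2) = 4 := by
  have h := card_torsionPoints_eq_sq_holds W (AlgebraicClosure ℚ) (n := 2) two_ne_zero
  norm_num at h
  exact h

omit [W.IsElliptic] [A.IsElliptic] in
/-- **An isogeny of even degree has a point of order `2` in its kernel** (Cauchy in the finite group `ker ψ`, whose order is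
`deg ψ`). [cite: SilvermanAEC2009, III.4.10(c)] -/
theorem exists_twoTorsion_mem_ker_of_even_degree (ψ : Isogeny W A) (heven : Even ψ.degree) :
    ∃ Q : geomPoints W, Q ≠ 0 ∧ (2 : ℤ) • Q = 0 ∧ ψ Q = 0 := by
  obtain ⟨Q, hQ⟩ := exists_prime_addOrderOf_dvd_card' (G := ψ.toAddMonoidHom.ker) 2 (even_iff_two_dvd.mp heven)
  refine ⟨(Q : geomPoints W), fun h0 ↦ ?_, ?_, Q.2⟩
  · have : Q = 0 := Subtype.ext h0
    rw [this, addOrderOf_zero] at hQ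
    exact absurd hQ (by norm_num)
  · have h2 : (2 : ℕ) • Q = 0 := by rw [← hQ]; exact addOrderOf_nsmul_eq_zero Q
    have h2' : (2 : ℕ) • (Q : geomPoints W) = 0 := by
      rw [← AddSubgroupClass.coe_nsmul, h2, ZeroMemClass.coe_zero]
    rw [← natCast_zsmul] at h2'
    exact_mod_cast h2'

omit [A.IsElliptic] in
/-- **No rational `2`-torsion and `deg ψ` even ⇒ `E[2] ⊆ ker ψ`.** The subgroup `H = ker ψ ∩ E[2]` of `E[2]` (order `4`) is
`Γ_ℚ`-stable and non-zero (Cauchy); if it were of order `2`, its non-zero element `Q` would satisfy `σQ = Q` for all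
`σ ∈ Γ_ℚ`, i.e. be a rational point of order `2` — excluded (`#E(ℚ)[2] = 1`); by Lagrange `#H = 4`, `H = E[2]`.
[cite: SilvermanAEC2009, III.4 (Remark 4.13.2) and VIII.§1] -/
theorem geomTorsion_two_le_ker_of_even_degree (h1 : ratTwoTorsionCard W = 1) (ψ : Isogeny W A)
    (heven : Even ψ.degree) : geomTorsion W 2 ≤ ψ.toAddMonoidHom.ker := by
  set K := ψ.toAddMonoidHom.ker with hK
  set G : AddSubgroup (geomPoints W) := geomTorsion W 2 with hG
  set H : AddSubgroup G := K.addSubgroupOf G with hH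
  have hG4 : Nat.card G = 4 := natCard_geomTorsion_two
  haveI : Finite G := Nat.finite_of_card_ne_zero (by rw [hG4]; norm_num)
  obtain ⟨Q, hQ0, hQ2, hQK⟩ := exists_twoTorsion_mem_ker_of_even_degree ψ heven
  have hQG : Q ∈ G := (mem_geomTorsion_iff W 2 Q).mpr hQ2
  have hmemH : ∀ (P : geomPoints W) (hP : P ∈ G), (⟨P, hP⟩ : G) ∈ H ↔ ψ P = 0 := fun P hP ↦ by
    rw [hH, AddSubgroup.mem_addSubgroupOf, hK, AddMonoidHom.mem_ker]
    rfl
  have hQH : (⟨Q, hQG⟩ : G) ∈ H := (hmemH Q hQG).mpr hQK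
  by_contra hle
  have hHtop : H ≠ ⊤ := fun h ↦ hle (AddSubgroup.addSubgroupOf_eq_top.mp h)
  -- `#H ∈ {1, 2, 4}`, not `4` (proper), not `1` (contains `Q ≠ 0`)
  have hdvd : Nat.card H ∣ 2 ^ 2 := by
    have := AddSubgroup.card_addSubgroup_dvd_card H
    rwa [hG4] at this
  have hH4 : Nat.card H ≠ 4 := fun h ↦ hHtop (AddSubgroup.card_eq_iff_eq_top H |>.mp (h.trans hG4.symm))
  have hH1 : Nat.card H ≠ 1 := by
    intro h
    haveI := (Nat.card_eq_one_iff_unique.mp h).1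
    have e : (⟨⟨Q, hQG⟩, hQH⟩ : H) = 0 := Subsingleton.elim _ _
    exact hQ0 (congrArg (fun x : H ↦ ((x : G) : geomPoints W)) e)
  have hH2 : Nat.card H = 2 := by
    obtain ⟨k, hk, hk'⟩ := (Nat.dvd_prime_pow Nat.prime_two).mp hdvd
    interval_cases k
    · exact absurd hk' hH1
    · simpa using hk'
    · exact absurd hk' hH4
  -- every `σ ∈ Γ_ℚ` fixes `Q`: `σQ` is a non-zero element of `H`, and `H` has exactly one
  obtain ⟨x, -, huniq⟩ := (Nat.card_eq_two_iff' (0 : H)).mp hH2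
  have hfix : ∀ σ : Field.absoluteGaloisGroup ℚ, σ • Q = Q := by
    intro σ
    have hσK : ψ (σ • Q) = 0 := by rw [ψ.map_smul, hQK, smul_zero]
    have hσG : σ • Q ∈ G := by
      rw [hG, mem_geomTorsion_iff, smul_comm, hQ2, smul_zero]
    have hσ0 : σ • Q ≠ 0 := by rwa [Ne, smul_eq_zero_iff_eq]
    have hσH : (⟨σ • Q, hσG⟩ : G) ∈ H := (hmemH _ hσG).mpr hσK
    have e1 := huniq ⟨⟨σ • Q, hσG⟩, hσH⟩ fun h ↦ hσ0 (congrArg (fun x : H ↦ ((x : G) : geomPoints W)) h)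
    have e2 := huniq ⟨⟨Q, hQG⟩, hQH⟩ fun h ↦ hQ0 (congrArg (fun x : H ↦ ((x : G) : geomPoints W)) h)
    exact congrArg (fun x : H ↦ ((x : G) : geomPoints W)) (e1.trans e2.symm)
  exact hQ0 (eq_zero_of_fixed_of_two_smul_eq_zero_of_ratTwoTorsionCard_eq_one W h1 hQ2 hfix)

/-- **If `E[2] ⊆ ker ψ` then `ψ = λ ∘ [2]` with `deg λ < deg ψ`** (Silverman AEC III.4.11: the tree's
`Isogeny.exists_eq_comp_nsmul_of_geomTorsion_le_ker_holds'`; `[2]` is onto on `E(ℚ̄)` with non-zero kernel inside `ker ψ`,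
so `#ker ψ = #ker λ · #([2]⁻¹-fibre) > #ker λ`). [cite: SilvermanAEC2009, Cor. III.4.11] -/
theorem exists_isogeny_degree_lt_of_geomTorsion_two_le_ker (ψ : Isogeny W A)
    (hle : geomTorsion W 2 ≤ ψ.toAddMonoidHom.ker) : ∃ lam : Isogeny W A, lam.degree < ψ.degree := by
  obtain ⟨lam, hlam⟩ := Isogeny.exists_eq_comp_nsmul_of_geomTorsion_le_ker_holds' W A (m := 2) (by norm_num) ψ
    fun P hP ↦ hle (by exact_mod_cast hP)
  refine ⟨lam, ?_⟩
  -- `f : ker ψ → ker λ`, `P ↦ 2P`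
  set Kψ := ψ.toAddMonoidHom.ker
  set Kl := lam.toAddMonoidHom.ker
  have hmap : ∀ P : geomPoints W, P ∈ Kψ → (2 : ℕ) • P ∈ Kl := fun P hP ↦ by
    rw [AddMonoidHom.mem_ker, Isogeny.coe_toAddMonoidHom, ← hlam]
    exact hP
  let f : Kψ →+ Kl :=
    { toFun := fun P ↦ ⟨(2 : ℕ) • (P : geomPoints W), hmap P P.2⟩
      map_zero' := by ext; simp
      map_add' := fun P R ↦ by ext; simp [smul_add] }
  have hf_surj : Function.Surjective f := by
    rintro ⟨R, hR⟩
    obtain ⟨P, hP⟩ := W.zsmul_geomPoints_surjective_holds (n := 2) two_ne_zero R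
    have hP' : (2 : ℕ) • P = R := by
      have : ((2 : ℕ) : ℤ) • P = R := by exact_mod_cast hP
      rwa [natCast_zsmul] at this
    have hPK : P ∈ Kψ := by
      rw [AddMonoidHom.mem_ker, Isogeny.coe_toAddMonoidHom, hlam, hP']
      exact hR
    exact ⟨⟨P, hPK⟩, Subtype.ext hP'⟩
  -- a non-zero element of `ker f`: a point of order `2` (inside `E[2] ⊆ ker ψ`)
  haveI : Finite (geomTorsion W 2) := Nat.finite_of_card_ne_zero (by rw [natCard_geomTorsion_two]; norm_num)
  obtain ⟨T, hT1⟩ : ∃ T : geomTorsion W 2, T ≠ 0 := by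
    by_contra h
    push Not at h
    haveI : Subsingleton (geomTorsion W 2) := ⟨fun a b ↦ by rw [h a, h b]⟩
    have := natCard_geomTorsion_two (W := W)
    rw [Nat.card_of_subsingleton (0 : geomTorsion W 2)] at this
    norm_num at this
  have hT2 : (2 : ℤ) • (T : geomPoints W) = 0 := (mem_geomTorsion_iff W 2 _).mp T.2
  have hTK : (T : geomPoints W) ∈ Kψ := hle T.2
  have hfT : f ⟨T, hTK⟩ = 0 := by
    apply Subtype.ext
    change (2 : ℕ) • (T : geomPoints W) = 0
    rw [← natCast_zsmul]
    exact_mod_cast hT2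
  have hT0 : (⟨T, hTK⟩ : Kψ) ≠ 0 := by
    intro h
    apply hT1
    have e : ((T : geomPoints W)) = 0 := congrArg Subtype.val h
    exact Subtype.ext e
  -- count: `#Kψ = #Kl · #ker f` with `#ker f ≥ 2`
  have hcard : Nat.card Kψ = Nat.card Kl * Nat.card f.ker := by
    rw [f.ker.card_eq_card_quotient_mul_card_addSubgroup,
      Nat.card_congr (QuotientAddGroup.quotientKerEquivOfSurjective f hf_surj).toEquiv]
  have hker2 : 1 < Nat.card f.ker := by
    rw [Finite.one_lt_card_iff_nontrivial]
    exact ⟨⟨⟨⟨T, hTK⟩, hfT⟩, 0, fun h ↦ hT0 (congrArg Subtype.val h)⟩⟩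
  have hpos : 0 < Nat.card Kl := Nat.card_pos
  change Nat.card Kl < Nat.card Kψ
  rw [hcard]
  nlinarith

/-- **No rational `2`-torsion ⇒ from any `ℚ`-isogeny `W → A`, one of ODD degree.** Strong induction on the degree: an even
degree forces `E[2] ⊆ ker ψ` (`geomTorsion_two_le_ker_of_even_degree`), hence a factorisation through `[2]` of smaller degree.
[cite: SilvermanAEC2009, Cor. III.4.11 and III.4 (Remark 4.13.2)] -/
theorem exists_isogeny_odd_degree_of_ratTwoTorsionCard_eq_one (h1 : ratTwoTorsionCard W = 1) (ψ : Isogeny W A) :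
    ∃ φ : Isogeny W A, Odd φ.degree := by
  suffices h : ∀ (n : ℕ) (ψ : Isogeny W A), ψ.degree = n → ∃ φ : Isogeny W A, Odd φ.degree from h _ ψ rfl
  intro n
  induction n using Nat.strong_induction_on with
  | _ n ih =>
    intro ψ hn
    rcases Nat.even_or_odd ψ.degree with heven | hodd
    · obtain ⟨lam, hlt⟩ := exists_isogeny_degree_lt_of_geomTorsion_two_le_ker ψ
        (geomTorsion_two_le_ker_of_even_degree h1 ψ heven)
      exact ih lam.degree (hn ▸ hlt) lam rfl
    · exact ⟨ψ, hodd⟩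

end OddIsogeny

/-! ## §3 Assembly: `Δ_W < 0`, no rational `2`-torsion ⇒ `Λ_f` rhombic -/

/-- Dictionary between the two spellings of «rhombic»: `z + z̄ ∉ 2Λ` for all of `Λ` (RTT files) versus `re z ∉ Λ`
(`F1Sign2.IsRhombic`), for any subgroup `Λ ≤ ℂ` (`z + z̄ = 2 re z`). [folklore] -/
theorem re_notMem_of_forall_add_conj_ne {Λ : AddSubgroup ℂ} {z : ℂ} (h : ∀ w ∈ Λ, z + conj z ≠ 2 * w) :
    ((z.re : ℂ)) ∉ Λ := fun hre ↦ h _ hre (by rw [Complex.add_conj]; push_cast; ring)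

/-- **`Δ_W < 0` and no rational `2`-torsion abscissa ⇒ `Λ_f` is rhombic** for every newform `f` of `W` (any elliptic `W/ℚ`,
not necessarily minimal). Assembly described in the module docstring: `Λ_W` rhombic; `E_f = ℂ/Λ_f` over `ℚ`; `cΛ_f ⊆ Λ_W`;
an odd-degree `ℚ`-isogeny `W → E_f`; its real multiplier `α` with `αΛ_W ⊆ Λ_f ⊇ ⋯ ⊇ mΛ_f ⊆ αΛ_W`, `m` odd; transport of
rhombicity. [cite: CremonaAlgorithms1997, §2.10 (pp. 29–30) and §2.14] [cite: SilvermanAEC2009, Thm. VI.4.1(b), VI.5.3] -/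
theorem isRhombic_of_Δ_neg_of_forall_not_hasRationalTwoTorsionX (W : WeierstrassCurve ℚ) [W.IsElliptic] (hΔ : W.Δ < 0)
    (ht : ∀ x : ℚ, ¬ HasRationalTwoTorsionX W x) {N : ℕ} [NeZero N] (f : CuspForm (Gamma0 N) 2) (hf : IsNewformOf W f) :
    IsRhombic f := by
  -- the Néron lattice of `W`: real and rhombic
  haveI : (W.baseChange ℂ).IsElliptic := by rw [WeierstrassCurve.baseChange]; infer_instance
  obtain ⟨LW, hLW⟩ := exists_isNeronLatticeOf_holds (W.baseChange ℂ)
  have hLWreal : LW.IsReal := WeierstrassCurve.isReal_of_g₂_g₃_eq (K := ℚ) hLW.1 hLW.2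
  have hrhW : ∃ z ∈ LW.lattice, ∀ w ∈ LW.lattice, z + conj z ≠ 2 * w := W.neronLattice_rhombic_of_Δ_neg hΔ hLW
  -- `E_f = ℂ/Λ_f`, an elliptic curve over `ℚ` with Néron lattice `Λ_f`
  obtain ⟨Lf, a₄, a₆, hΛ, hE, hLf⟩ := hf.1.exists_shortModel_periodLattice hf.coeffField_eq_bot
  haveI := hE
  have hmemf : ∀ z : ℂ, z ∈ Lf.lattice ↔ z ∈ periodLattice f := fun z ↦ by
    rw [← Submodule.mem_toAddSubgroup, hΛ]
  -- `cΛ_f ⊆ Λ_W`, hence a `ℚ`-isogeny `E_f → W`, hence `W → E_f`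
  obtain ⟨c, hc0, hc⟩ := IsNewformOf.exists_maninConstant_ne_zero_holds hf hLW
  have hiso : IsIsogenous ({ a₁ := 0, a₂ := 0, a₃ := 0, a₄ := a₄, a₆ := a₆ } : WeierstrassCurve ℚ) W :=
    isIsogenous_of_forall_mul_mem_lattice hLf.1 hLf.2 hLW.1 hLW.2 (c := (c : ℚ)) (by exact_mod_cast hc0)
      fun z hz ↦ by
        rw [Rat.cast_intCast]
        exact hc z ((hmemf z).mp hz)
  obtain ⟨ψ₀⟩ := hiso
  obtain ⟨ψ⟩ := ψ₀.nonempty_symm_of_isElliptic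
  -- an odd-degree isogeny `W → E_f` and its real multiplier
  obtain ⟨φ, hodd⟩ := exists_isogeny_odd_degree_of_ratTwoTorsionCard_eq_one
    (ratTwoTorsionCard_eq_one_of_forall_not_hasRationalTwoTorsionX W ht) ψ
  obtain ⟨α, hα, hWf, hfW⟩ := φ.exists_real_mul_lattice_le_of_isNeronLatticeOf hLW hLf
  -- transport: `Λ_W` rhombic ⇒ `αΛ_W` rhombic ⇒ `Λ_f` rhombic (odd index)
  set B₁ : AddSubgroup ℂ := (LW.lattice.toAddSubgroup).map (AddMonoidHom.mulLeft (α : ℂ)) with hB₁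
  have hB₁mem : ∀ z, z ∈ B₁ ↔ ∃ a ∈ LW.lattice.toAddSubgroup, z = (α : ℂ) * a := fun z ↦ by
    simp only [hB₁, AddSubgroup.mem_map, AddMonoidHom.coe_mulLeft]
    exact ⟨fun ⟨a, ha, e⟩ ↦ ⟨a, ha, e.symm⟩, fun ⟨a, ha, e⟩ ↦ ⟨a, ha, e.symm⟩⟩
  have h1 : ∃ z ∈ B₁, ∀ w ∈ B₁, z + conj z ≠ 2 * w :=
    rhombic_of_rhombic_real_mul (A := LW.lattice.toAddSubgroup) hα hB₁mem hrhW
  have hB₁le : B₁ ≤ Lf.lattice.toAddSubgroup := fun z hz ↦ by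
    obtain ⟨a, ha, rfl⟩ := (hB₁mem z).mp hz
    exact hWf a ha
  have hB₁conj : ∀ z ∈ B₁, conj z ∈ B₁ := fun z hz ↦ by
    obtain ⟨a, ha, rfl⟩ := (hB₁mem z).mp hz
    exact (hB₁mem _).mpr ⟨conj a, hLWreal a ha, by rw [map_mul, Complex.conj_ofReal]⟩
  have hmB : ∀ b ∈ Lf.lattice.toAddSubgroup, (φ.degree : ℂ) * b ∈ B₁ := fun b hb ↦ by
    obtain ⟨z, hz, e⟩ := hfW b hb
    exact (hB₁mem _).mpr ⟨z, hz, e⟩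
  obtain ⟨z, hz, hzw⟩ := rhombic_of_rhombic_sub_of_odd_index hB₁le hB₁conj hodd hmB h1
  exact ⟨z, (hmemf z).mp hz, re_notMem_of_forall_add_conj_ne fun w hw ↦ hzw w ((hmemf w).mpr hw)⟩

/-- **The registered C1 stub `stub_rhombicOfNegDisc`, PROVED: `F1Sign2.RhombicOfNegDisc` holds** — for a globally minimal
elliptic `W/ℚ` with `Δ_W < 0` and no rational `2`-torsion abscissa, the period lattice `Λ_f` of every newform `f` of `W` is
rhombic (`IsRhombic f`). Unconditional (no named fact as hypothesis); global minimality is not used. Closes nothing by itself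
(`--supports stmt-BirchSwinnertonDyer-22296`): the C1 skeleton v16 may cite this theorem in place of its `sorry`.
[cite: CremonaAlgorithms1997, §2.10 (pp. 29–30)] [cite: SilvermanAEC2009, Thm. VI.4.1(b), Cor. III.4.11] -/
theorem rhombicOfNegDisc_holds : RhombicOfNegDisc :=
  fun W _ _ hΔ ht _ _ f hf ↦ isRhombic_of_Δ_neg_of_forall_not_hasRationalTwoTorsionX W hΔ ht f hf

/-- **The registered stub `stub_rhombicOfNegDisc` of the C1 skeleton (`Cruxes/MainConjectureTransportAlignedAtTwo/Lines/birth.lean`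
v16/v17), by its registered name and signature** — the same theorem as `rhombicOfNegDisc_holds`, exported under the stub's header so that
the skeleton's `sorry` can be replaced verbatim (`stub_rhombicOfNegDisc := …RhombicOfNegDisc.stub_rhombicOfNegDisc`). Closes nothing by itself.
[cite: CremonaAlgorithms1997, §2.10 (pp. 29–30)] [cite: SilvermanAEC2009, Thm. VI.4.1(b), Cor. III.4.11] -/
theorem stub_rhombicOfNegDisc : RhombicOfNegDisc :=
  rhombicOfNegDisc_holds

end Summit.BirchSwinnertonDyer.BirchSwinnertonDyer.Theorems.AlignedTransportAtTwoRhombicOfNegDisc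

end
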